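import Literature.Computability.Complexity.UniversalTM2
import Literature.Computability.Complexity.Oracle
import HarnessLib

/-!
# A uniformly primitive recursive enumeration of all polynomial-time oracle algorithms

Every oracle construction by diagonalization or encoding ("let `M₁, M₂, …` be an enumeration of
all polynomial-time oracle machines", Baker–Gill–Solovay 1975, §1; Arora–Barak 2009, §1.4 and
proof of Thm. 3.7) needs such an enumeration; `BakerGillSolovay.lean` obtains one abstractly
from countability (`countable_setOf_isPolyTime`), which suffices for the *existence* of the
oracles but not for their *recursiveness*. Here we give a concrete enumeration whose step
functions are computable **uniformly** in the index:

* `UnivTM2.ustepFn D x answers` — the step function of the *clocked standard machine* with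
  index data `D : UnivTM2.Idx` (a coded standard `TM2` program with its stack/label/state data,
  the codes of the two input symbols, the table decoding output symbols into bits, and a clock
  `c · n ^ d + c`), as an oracle-algorithm step in the transcript model of `Oracle.lean`: code
  the input word `boolPair x (listBool.encode answers)`, run the primitive recursive interpreter
  `UnivTM2.urun` (`UniversalTM2.lean`) for `c · n ^ d + c` steps, decode the output stack and
  parse the sum encoding (`UnivTM2.parseSum`);
* `UnivTM2.primrec_ustepFn` — `(D, x, answers) ↦ ustepFn D x answers` is primitive recursive;
* `UnivTM2.ustepFn_idxOf`, `UnivTM2.exists_idx_of_isPolyTime` — universality: by the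
  compilation to standard machines (`TM2Std.outputs_tr`, `PolyTimeCountable.lean`) and the
  correctness of the interpreter (`UnivTM2.urun_of_outputsInTime`), every polynomial-time oracle
  algorithm `M` (`OracleAlg.IsPolyTime`) has index data `D` with `ustepFn D = M.step`;
* `UnivTM2.stdEnum : ℕ → OracleAlg Bool` — decode the index and take `ustepFn`; it contains
  every polynomial-time oracle algorithm (`UnivTM2.isPolyTime_subset_range_stdEnum`) and
  `(i, x, answers) ↦ (stdEnum i).step x answers` is primitive recursive
  (`UnivTM2.primrec_stdEnum_step`).

On the way: `boolPair`, `unaryEncodeNat`, the list-of-strings encoder and the clock are primitive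
recursive. The enumeration also contains junk (non-polynomial-time, even non-total-looking but
in fact clocked, hence total) algorithms; consumers (`BGS.oracleA`) only need that it *covers* the
polynomial-time ones.

## References

* T. Baker, J. Gill, R. Solovay, *Relativizations of the P =? NP question*, SIAM J. Comput. 4
  (1975) 431–442, §1 [BakerGillSolovay1975].
* S. Arora, B. Barak, *Computational Complexity: A Modern Approach*, CUP 2009, §1.4 (machines as
  strings, efficient universal machine Thm. 1.9), §3.4 (oracle machines) [AroraBarakCC2009].
-/

namespace Literature.Computability.Complexity

namespace UnivTM2

open _root_.Computability Encodable Turing TM2Std Function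

/-! ### The string toolkit is primitive recursive -/

/-- `boolPair` is primitive recursive. [folklore] -/
theorem primrec_boolPair : Primrec₂ boolPair := by
  have h : Primrec (fun p : List Bool × List Bool =>
      (p.1.flatMap fun b => [b, b]) ++ ([false, true] ++ p.2)) :=
    Primrec.list_append.comp (Primrec.list_flatMap Primrec.fst
      ((Primrec.list_cons.comp Primrec.snd (Primrec.list_cons.comp Primrec.snd (Primrec.const []))).to₂))
      (Primrec.list_append.comp (Primrec.const [false, true]) Primrec.snd)
  exact Primrec₂.mk (h.of_eq fun p => by simp [boolPair, List.append_assoc])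

/-- `unaryEncodeNat` is primitive recursive. [folklore] -/
theorem primrec_unaryEncodeNat : Primrec unaryEncodeNat := by
  have h : Primrec (fun n : ℕ => (List.cons true)^[n] ([] : List Bool)) :=
    Primrec.nat_iterate Primrec.id (Primrec.const []) ((Primrec.list_cons.comp (Primrec.const true) Primrec.snd).to₂)
  refine h.of_eq fun n => ?_
  induction n with
  | zero => rfl
  | succ n ih => rw [iterate_succ_apply', ih]; rfl

/-- The list-of-strings encoder of the transcript model is primitive recursive. [folklore] -/
theorem primrec_listBoolEncode : Primrec ((encodingList Bool).listBool.encode) := by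
  have h : Primrec (fun l : List (List Bool) =>
      boolPair (unaryEncodeNat l.length) (l.foldr (fun a acc => boolPair a acc) [])) :=
    primrec_boolPair.comp (primrec_unaryEncodeNat.comp Primrec.list_length)
      (Primrec.list_foldr Primrec.id (Primrec.const [])
        ((primrec_boolPair.comp (Primrec.fst.comp Primrec.snd) (Primrec.snd.comp Primrec.snd)).to₂))
  exact h.of_eq fun l => rfl

/-- The input word of an oracle algorithm's step function is primitive recursive in
(input, answers). [folklore] -/
theorem primrec_oracleInput {α : Type} [Primcodable α] {f : α → List Bool} {g : α → List (List Bool)}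
    (hf : Primrec f) (hg : Primrec g) :
    Primrec fun a => boolPair (f a) ((encodingList Bool).listBool.encode (g a)) :=
  primrec_boolPair.comp hf (primrec_listBoolEncode.comp hg)

/-! ### Parsing the output word -/

/-- Parsing an output word `false :: q` / `true :: b :: _` of the sum encoding back into the
step result `inl q` / `inr b` (junk `inr false`). [folklore] -/
def parseSum (l : List Bool) : List Bool ⊕ Bool :=
  if l.head? = some false then Sum.inl l.tail else Sum.inr l.tail.headI

/-- `parseSum` inverts the sum encoding. [folklore] -/
theorem parseSum_encode (s : List Bool ⊕ Bool) :
    parseSum (((encodingList Bool).sumBool encodingBoolBool).encode s) = s := by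
  rcases s with q | b <;> rfl

/-- `parseSum` is primitive recursive. [folklore] -/
theorem primrec_parseSum : Primrec parseSum := by
  unfold parseSum
  refine Primrec.ite (Primrec.eq.comp Primrec.list_head? (Primrec.const (some false)))
    (Primrec.sumInl.comp Primrec.list_tail)
    (Primrec.sumInr.comp (Primrec.list_headI.comp Primrec.list_tail))

/-! ### Clocks -/

/-- The clock `c · n ^ d + c`, written as an iterated product (primitive recursive without a
power function). [folklore] -/
def clockFn (c d n : ℕ) : ℕ := (fun m => m * n)^[d] c + c

/-- The iterated-product clock is `c · n ^ d + c`. [folklore] -/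
theorem clockFn_eq (c d n : ℕ) : clockFn c d n = c * n ^ d + c := by
  unfold clockFn
  congr 1
  induction d with
  | zero => simp
  | succ d ih => rw [iterate_succ_apply', ih, pow_succ, mul_assoc]

/-- The clock is primitive recursive (composed form). [folklore] -/
theorem primrec_clockFn {α : Type} [Primcodable α] {f g h : α → ℕ} (hf : Primrec f) (hg : Primrec g)
    (hh : Primrec h) : Primrec fun a => clockFn (f a) (g a) (h a) := by
  unfold clockFn
  exact Primrec.nat_add.comp
    (Primrec.nat_iterate hg hf ((Primrec.nat_mul.comp Primrec.snd (hh.comp Primrec.fst)).to₂)) hf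

/-! ### Index data of clocked standard machines -/

/-- The index data of a clocked standard machine with Boolean input/output alphabets:
`((prog, nK, k₀, k₁, main, init), ((code of input symbol 0, code of input symbol 1),
table decoding output symbols to bits), (c, d))` with clock `c · n ^ d + c`.
[cite: AroraBarakCC2009, §1.4] -/
abbrev Idx : Type := (List ℕ × ℕ × ℕ × ℕ × ℕ × ℕ) × ((ℕ × ℕ) × List Bool) × (ℕ × ℕ)

namespace Idx

variable (D : Idx)

/-- The coded program. [folklore] -/
def prog : List ℕ := D.1.1
/-- The number of stacks. [folklore] -/
def nK : ℕ := D.1.2.1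
/-- The input stack. [folklore] -/
def k₀ : ℕ := D.1.2.2.1
/-- The output stack. [folklore] -/
def k₁ : ℕ := D.1.2.2.2.1
/-- The main label. [folklore] -/
def main : ℕ := D.1.2.2.2.2.1
/-- The initial state. [folklore] -/
def init : ℕ := D.1.2.2.2.2.2
/-- The codes of the two input symbols `false`, `true`. [folklore] -/
def io : ℕ × ℕ := D.2.1.1
/-- The table decoding codes of output symbols into bits. [folklore] -/
def outTab : List Bool := D.2.1.2
/-- The clock coefficient `c`. [folklore] -/
def cc : ℕ := D.2.2.1
/-- The clock exponent `d`. [folklore] -/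
def dd : ℕ := D.2.2.2

/-- The program projection is primitive recursive. [folklore] -/
theorem primrec_prog : Primrec prog := Primrec.fst.comp Primrec.fst
/-- The stack-number projection is primitive recursive. [folklore] -/
theorem primrec_nK : Primrec nK := Primrec.fst.comp (Primrec.snd.comp Primrec.fst)
/-- The input-stack projection is primitive recursive. [folklore] -/
theorem primrec_k₀ : Primrec k₀ := Primrec.fst.comp (Primrec.snd.comp (Primrec.snd.comp Primrec.fst))
/-- The output-stack projection is primitive recursive. [folklore] -/
theorem primrec_k₁ : Primrec k₁ :=
  Primrec.fst.comp (Primrec.snd.comp (Primrec.snd.comp (Primrec.snd.comp Primrec.fst)))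
/-- The main-label projection is primitive recursive. [folklore] -/
theorem primrec_main : Primrec main :=
  Primrec.fst.comp (Primrec.snd.comp (Primrec.snd.comp (Primrec.snd.comp (Primrec.snd.comp Primrec.fst))))
/-- The initial-state projection is primitive recursive. [folklore] -/
theorem primrec_init : Primrec init :=
  Primrec.snd.comp (Primrec.snd.comp (Primrec.snd.comp (Primrec.snd.comp (Primrec.snd.comp Primrec.fst))))
/-- The input-symbol-codes projection is primitive recursive. [folklore] -/
theorem primrec_io : Primrec io := Primrec.fst.comp (Primrec.fst.comp Primrec.snd)
/-- The output-table projection is primitive recursive. [folklore] -/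
theorem primrec_outTab : Primrec outTab := Primrec.snd.comp (Primrec.fst.comp Primrec.snd)
/-- The clock-coefficient projection is primitive recursive. [folklore] -/
theorem primrec_cc : Primrec cc := Primrec.fst.comp (Primrec.snd.comp Primrec.snd)
/-- The clock-exponent projection is primitive recursive. [folklore] -/
theorem primrec_dd : Primrec dd := Primrec.snd.comp (Primrec.snd.comp Primrec.snd)

end Idx

/-- Coding an input bit by the code of the corresponding input symbol. [folklore] -/
def inpCode (io : ℕ × ℕ) (b : Bool) : ℕ := if b then io.2 else io.1

/-- `inpCode` is primitive recursive. [folklore] -/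
theorem primrec_inpCode : Primrec₂ inpCode := by
  unfold inpCode
  exact Primrec₂.mk (Primrec.ite (Primrec.eq.comp Primrec.snd (Primrec.const true))
    (Primrec.snd.comp Primrec.fst) (Primrec.fst.comp Primrec.fst))

/-- The coded initial configuration on an input word. [folklore] -/
def initCfg (D : Idx) (inp : List Bool) : Option ℕ × ℕ × List (List ℕ) :=
  (some D.main, D.init, (List.replicate D.nK []).set D.k₀ (inp.map (inpCode D.io)))

/-- `n ↦ [[], …, []]` (`n` empty stacks) is primitive recursive. [folklore] -/
theorem primrec_replicate_nil : Primrec (fun n : ℕ => List.replicate n ([] : List ℕ)) := by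
  have h : Primrec (fun n : ℕ => (List.cons ([] : List ℕ))^[n] []) :=
    Primrec.nat_iterate Primrec.id (Primrec.const [])
      ((Primrec.list_cons.comp (Primrec.const []) Primrec.snd).to₂)
  refine h.of_eq fun n => ?_
  induction n with
  | zero => rfl
  | succ n ih => rw [iterate_succ_apply', ih]; rfl

/-- `initCfg` is primitive recursive. [folklore] -/
theorem primrec_initCfg : Primrec₂ initCfg := by
  unfold initCfg
  refine Primrec₂.mk (Primrec.pair (Primrec.option_some.comp (Idx.primrec_main.comp Primrec.fst))
    (Primrec.pair (Idx.primrec_init.comp Primrec.fst) ?_))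
  refine Primrec.list_set.comp (primrec_replicate_nil.comp (Idx.primrec_nK.comp Primrec.fst))
    (Primrec.pair (Idx.primrec_k₀.comp Primrec.fst) ?_)
  exact Primrec.list_map Primrec.snd (primrec_inpCode.comp (Idx.primrec_io.comp (Primrec.fst.comp Primrec.fst))
    Primrec.snd).to₂

/-- Reading the output bits off a coded configuration. [folklore] -/
def outBits (D : Idx) (C : Option ℕ × ℕ × List (List ℕ)) : List Bool :=
  (C.2.2.getD D.k₁ []).map fun j => D.outTab.getD j false

/-- `outBits` is primitive recursive. [folklore] -/
theorem primrec_outBits : Primrec₂ outBits := by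
  unfold outBits
  refine Primrec₂.mk (Primrec.list_map
    ((Primrec.list_getD []).comp (Primrec.snd.comp (Primrec.snd.comp Primrec.snd)) (Idx.primrec_k₁.comp Primrec.fst))
    ?_)
  exact ((Primrec.list_getD false).comp (Idx.primrec_outTab.comp (Primrec.fst.comp Primrec.fst)) Primrec.snd).to₂

/-- **The universal step function**: the step function of the clocked standard machine with
index data `D`, as an oracle-algorithm step (input, answers) ↦ query/output: code the input
word, run the interpreter for `c · n ^ d + c` steps, decode the output stack and parse it.
[cite: AroraBarakCC2009, §1.4 (universal simulation)] [cite: BakerGillSolovay1975, §1] -/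
def ustepFn (D : Idx) (x : List Bool) (as : List (List Bool)) : List Bool ⊕ Bool :=
  parseSum (outBits D (urun D.prog (initCfg D (boolPair x ((encodingList Bool).listBool.encode as)))
    (clockFn D.cc D.dd (boolPair x ((encodingList Bool).listBool.encode as)).length)))

/-- **The universal step function is primitive recursive** (jointly in the index data, the
input and the answers). [cite: AroraBarakCC2009, §1.4] -/
theorem primrec_ustepFn : Primrec (fun p : Idx × List Bool × List (List Bool) => ustepFn p.1 p.2.1 p.2.2) := by
  unfold ustepFn
  have hin : Primrec (fun p : Idx × List Bool × List (List Bool) =>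
      boolPair p.2.1 ((encodingList Bool).listBool.encode p.2.2)) :=
    primrec_oracleInput (Primrec.fst.comp Primrec.snd) (Primrec.snd.comp Primrec.snd)
  refine primrec_parseSum.comp (primrec_outBits.comp Primrec.fst ?_)
  exact primrec_urun (Idx.primrec_prog.comp Primrec.fst) (primrec_initCfg.comp Primrec.fst hin)
    (primrec_clockFn (Idx.primrec_cc.comp Primrec.fst) (Idx.primrec_dd.comp Primrec.fst)
      (Primrec.list_length.comp hin))

/-! ### Universality -/

/-- The index data of a machine with Boolean alphabets and a clock `c · n ^ d + c`: its
standard machine (`TM2Std.stdCode`), the codes of the two input symbols, the table decoding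
the codes of output symbols into bits, and the clock. [cite: AroraBarakCC2009, §1.4] -/
noncomputable def idxOf (T : TM2ComputableAux Bool Bool) (cc dd : ℕ) : Idx :=
  ((encProg (TM2Std.stdCode T.tm), (TM2Std.stdCode T.tm).nK, ((TM2Std.stdCode T.tm).k₀ : ℕ),
      ((TM2Std.stdCode T.tm).k₁ : ℕ), ((TM2Std.stdCode T.tm).main : ℕ), ((TM2Std.stdCode T.tm).init : ℕ)),
    (((TM2Std.enc T.tm ⟨T.tm.k₀, T.inputAlphabet.symm false⟩ : ℕ),
        (TM2Std.enc T.tm ⟨T.tm.k₀, T.inputAlphabet.symm true⟩ : ℕ)),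
      List.ofFn (fun j : Fin (TM2Std.stdN T.tm + 1) =>
        ((TM2Std.decOpt T.tm T.tm.k₁ (some j)).map T.outputAlphabet).getD false)),
    (cc, dd))

/-- **Universality of `ustepFn`.** If the machine `T` outputs `y` on `w` within `c · |w| ^ d + c`
steps, then the universal step function with index data `idxOf T c d` maps `w`'s constituents to
the parse of `y`: for an oracle algorithm whose step function `T` computes within that clock,
`ustepFn (idxOf T c d)` *is* the step function. [cite: AroraBarakCC2009, §1.4] [cite: BakerGillSolovay1975, §1] -/
theorem ustepFn_idxOf (T : TM2ComputableAux Bool Bool) (cc dd : ℕ) (x : List Bool) (as : List (List Bool))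
    (y : List Bool) {m : ℕ}
    (h : T.OutputsWithin (boolPair x ((encodingList Bool).listBool.encode as)) y m)
    (hm : m ≤ cc * (boolPair x ((encodingList Bool).listBool.encode as)).length ^ dd + cc) :
    ustepFn (idxOf T cc dd) x as = parseSum y := by
  set w := boolPair x ((encodingList Bool).listBool.encode as) with hw
  obtain ⟨h1, h2⟩ := TM2Std.outputs_tr T.tm h
  have key := urun_of_outputsInTime (TM2Std.stdCode T.tm) h1 (m' := clockFn cc dd w.length)
    (by rw [clockFn_eq]; exact hm)
  -- the coded input word is the one the universal step function prepares
  have hin : (TM2Std.stkCode T.tm T.tm.k₀ (w.map T.inputAlphabet.symm)).map Fin.val =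
      w.map (inpCode (idxOf T cc dd).io) := by
    simp only [TM2Std.stkCode, List.map_map]
    refine List.map_congr_left fun b _ => ?_
    cases b <;> rfl
  unfold ustepFn
  congr 1
  change outBits (idxOf T cc dd) (urun (encProg (TM2Std.stdCode T.tm))
    (some ((TM2Std.stdCode T.tm).main : ℕ), ((TM2Std.stdCode T.tm).init : ℕ),
      (List.replicate (TM2Std.stdCode T.tm).nK []).set (TM2Std.stdCode T.tm).k₀
        (w.map (inpCode (idxOf T cc dd).io)))
    (clockFn cc dd w.length)) = y
  rw [← hin, key]
  unfold outBits
  change (((List.replicate (TM2Std.stdCode T.tm).nK ([] : List ℕ)).set (TM2Std.stdCode T.tm).k₁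
      ((TM2Std.stkCode T.tm T.tm.k₁ (y.map T.outputAlphabet.symm)).map Fin.val)).getD
        (TM2Std.stdCode T.tm).k₁ []).map (fun j => (idxOf T cc dd).outTab.getD j false) = y
  rw [getD_set_replicate]
  simp only [TM2Std.stkCode, List.map_map]
  conv_rhs => rw [← List.map_id y]
  refine List.map_congr_left fun b hb => ?_
  have hallowed := h2 (T.outputAlphabet.symm b) (List.mem_map.2 ⟨b, hb, rfl⟩)
  change (List.ofFn fun j : Fin (TM2Std.stdN T.tm + 1) =>
      ((TM2Std.decOpt T.tm T.tm.k₁ (some j)).map T.outputAlphabet).getD false).getD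
        (TM2Std.enc T.tm ⟨T.tm.k₁, T.outputAlphabet.symm b⟩ : ℕ) false = b
  rw [getD_ofFn, TM2Std.decOpt_enc T.tm hallowed]
  simp

/-- **Every polynomial-time oracle algorithm is a clocked standard machine**: its step function
is `ustepFn D` for some index data `D`. [cite: BakerGillSolovay1975, §1] [cite: AroraBarakCC2009, §1.4] -/
theorem exists_idx_of_isPolyTime {M : OracleAlg Bool} (hM : M.IsPolyTime encodingBoolBool) :
    ∃ D : Idx, ∀ x as, ustepFn D x as = M.step x as := by
  obtain ⟨p, T, hT⟩ := hM
  obtain ⟨cc, dd, hcd⟩ := exists_eval_le_mul_pow_add p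
  refine ⟨idxOf T cc dd, fun x as => ?_⟩
  rw [ustepFn_idxOf T cc dd x as _ (hT (x, as)) (hcd _), parseSum_encode]
  rfl

/-! ### The enumeration -/

/-- **The standard enumeration of oracle algorithms**: index `i` decodes to index data `D` and
denotes the oracle algorithm with step function `ustepFn D` (a trivial algorithm if `i` is not
a code). [cite: BakerGillSolovay1975, §1 (the enumeration of oracle machines)] [cite: AroraBarakCC2009, §1.4] -/
def stdEnum (i : ℕ) : OracleAlg Bool where
  step x as := match decode (α := Idx) i with
    | some D => ustepFn D x as
    | none => Sum.inr false

/-- **The standard enumeration contains every polynomial-time oracle algorithm.**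
[cite: BakerGillSolovay1975, §1] [cite: AroraBarakCC2009, §1.4] -/
theorem isPolyTime_subset_range_stdEnum :
    {M : OracleAlg Bool | M.IsPolyTime encodingBoolBool} ⊆ Set.range stdEnum := by
  intro M hM
  obtain ⟨D, hD⟩ := exists_idx_of_isPolyTime hM
  refine ⟨encode D, ?_⟩
  obtain ⟨s⟩ := M
  unfold stdEnum
  congr 1
  funext x as
  simp only [encodek]
  exact hD x as

/-- **The standard enumeration is uniformly primitive recursive**: `(i, x, answers) ↦
(stdEnum i).step x answers` is primitive recursive. [cite: AroraBarakCC2009, §1.4] -/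
theorem primrec_stdEnum_step :
    Primrec (fun p : ℕ × List Bool × List (List Bool) => (stdEnum p.1).step p.2.1 p.2.2) := by
  have h : Primrec (fun p : ℕ × List Bool × List (List Bool) =>
      Option.casesOn (motive := fun _ => List Bool ⊕ Bool) (decode (α := Idx) p.1) (Sum.inr false)
        (fun D => ustepFn D p.2.1 p.2.2)) := by
    refine Primrec.option_casesOn (Primrec.decode.comp Primrec.fst) (Primrec.const _) ?_
    exact (primrec_ustepFn.comp (Primrec.pair Primrec.snd
      (Primrec.pair (Primrec.fst.comp (Primrec.snd.comp Primrec.fst))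
        (Primrec.snd.comp (Primrec.snd.comp Primrec.fst))))).to₂
  refine h.of_eq fun p => ?_
  simp only [stdEnum]
  cases decode (α := Idx) p.1 <;> rfl

end UnivTM2

end Literature.Computability.Complexity
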